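import Literature.Probability.Distributions.GaussianVectorTilt
import Literature.Probability.LatticeModels.DiscreteGFFMarkov
import HarnessLib

/-!
# Sign-flip invariance of the boundary-tilted GFF law on a finite set (Lupu's symmetry)

Topic `Literature/Probability/LatticeModels`. The analytic core of Lupu's observation that a BOUNDED
cluster of the cable-system Gaussian free field has a symmetric sign (T. Lupu, Ann. Probab. 44
(2016), arXiv:1402.0298, Lemma 3.2 and the proof of Prop. 4.2: the closed-edge factor
`e^{-C(|ψψ| + ψψ)}` combined with the Gaussian density is the density of the field with those edges
removed, whose sign on each finite component is a fair coin), written for the discrete GFF `φ` of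
`ℤ^d`, `d ≥ 3`, at an arbitrary level `-h` (`ψ = h + φ`), in vertex-trace form and WITHOUT densities
on `ℝ^K`:

* `harmonicExt`, `boundarySource`, `boundaryPairing` — `(Hb)_u = ∑_s H_K(u,s) b_s`,
  `β_v(b) = ∑_{s ∼ v} b_s` (so `Hb = G_K β(b)`, `harmonicExt_eq_sum_dirichletGreen`),
  `⟪f, b⟫ = ∑_{u ∼ s} f_u b_s`; `add_eval_eq_harmonicExt_add_markovRemainder`:
  `ψ|_K = H ψ|_{∂K} + Z` (`∑_s H = 1`);
* **`IsDiscreteGFF.map_flip_withDensity_eq`** — for every measurable weight `W ≥ 0` of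
  `(ψ|_K, ψ|_{∂K})` with `W(-f, b) = W(f, b) e^{2⟪f, b⟫}`, the measure `W · Law(ψ|_K, ψ|_{∂K})` is
  invariant under `(f, b) ↦ (-f, b)`. Proof: disintegrate along the independent pair
  `(Z, ψ|_{∂K})` (`DiscreteGFFMarkov.lean`); for fixed boundary data `b`, the reflection
  `f ↦ -f` is `z ↦ -z - 2Hb` on `Z`, and `2Hb = G_K (2β(b))` is in Cameron–Martin form, so the
  reflected tilt formula of `GaussianVectorTilt.lean` gives the density `e^{-2⟪β(b), z + Hb⟫}`, which
  the flip relation of `W` exactly compensates;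
* `closedBoundaryWeight K f b = ∏_{u ∼ s} exp(-2 (f_u b_s)⁺)` — the probability, given the field,
  that all cables from `K` to `∂K` are closed in the two-sided Lupu model (`closedBoundaryWeight_neg`:
  it satisfies the flip relation), and the integral form
  **`IsDiscreteGFF.integral_flip_closedBoundaryWeight`**:
  `E[G(-ψ|_K, ψ|_{∂K}) W_K] = E[G(ψ|_K, ψ|_{∂K}) W_K]` for every measurable `G`.

Used by `CableGFFLevelSetsProofs.lean` (percolation of the cable-system level sets below `0`).
-/

noncomputable section

namespace Literature.Probability.LatticeModels

open _root_.MeasureTheory _root_.ProbabilityTheory Finset Matrix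

variable {d : ℕ} {Ω : Type*} [MeasurableSpace Ω] {P : Measure Ω} {g : Site d → Ω → ℝ}

/-! ### The sign-flip invariance (Lupu's symmetry of bounded clusters, analytic core) -/

section Flip

variable (K : Finset (Site d))

/-- The harmonic extension to `K` of boundary data `b` on `∂K`: `(Hb)_u = ∑_{s ∈ ∂K} H_K(u,s) b_s`.
[folklore] -/
def harmonicExt (b : outerBoundary (zdGraph d) K → ℝ) (u : K) : ℝ :=
  ∑ s : outerBoundary (zdGraph d) K, poissonKernel K u s * b s

/-- The boundary source of boundary data `b`: `β_v(b) = ∑_{s ∈ ∂K, s ∼ v} b_s` (`v ∈ K`), so that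
`Hb = G_K β(b)`. [folklore] -/
def boundarySource (b : outerBoundary (zdGraph d) K → ℝ) (v : K) : ℝ :=
  ∑ s : outerBoundary (zdGraph d) K, if (zdGraph d).Adj (v : Site d) s then b s else 0

/-- The boundary pairing `⟪f, b⟫ = ∑_{u ∈ K, s ∈ ∂K, u ∼ s} f_u b_s = ∑_u f_u β_u(b)`. [folklore] -/
def boundaryPairing (f : K → ℝ) (b : outerBoundary (zdGraph d) K → ℝ) : ℝ :=
  ∑ u : K, f u * boundarySource K b u

/-- `Hb = G_K β(b)`: the harmonic extension is the Green potential of the boundary source.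
[folklore] -/
theorem harmonicExt_eq_sum_dirichletGreen (b : outerBoundary (zdGraph d) K → ℝ) (u : K) :
    harmonicExt K b u = ∑ v : K, dirichletGreen K u v * boundarySource K b v := by
  classical
  -- zero extension of the boundary data
  set φ : Site d → ℝ := fun z => if hz : z ∈ outerBoundary (zdGraph d) K then b ⟨z, hz⟩ else 0
    with hφ
  have h := sum_poissonKernel_mul_eq_sum_dirichletGreen_mul K (u : Site d) φ
  have hL : harmonicExt K b u = ∑ s ∈ outerBoundary (zdGraph d) K, poissonKernel K u s * φ s := by
    rw [harmonicExt, ← Finset.sum_coe_sort (outerBoundary (zdGraph d) K)]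
    refine Finset.sum_congr rfl fun s _ => ?_
    simp only [hφ, s.2, dif_pos]
  have hR : (∑ v : K, dirichletGreen K u v * boundarySource K b v) =
      ∑ v ∈ K, dirichletGreen K u v *
        ∑ s ∈ outerBoundary (zdGraph d) K, if (zdGraph d).Adj v s then φ s else 0 := by
    rw [← Finset.sum_coe_sort K]
    refine Finset.sum_congr rfl fun v _ => ?_
    congr 1
    rw [boundarySource, ← Finset.sum_coe_sort (outerBoundary (zdGraph d) K)]
    refine Finset.sum_congr rfl fun s _ => ?_
    simp only [hφ, s.2, dif_pos]
  rw [hL, hR, h]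

variable {K}

omit [MeasurableSpace Ω] in
/-- **The Markov decomposition**: on `K`, `h + φ_u = (H(h + φ|_{∂K}))_u + Z_u` (`d ≥ 1`, using
`∑_s H_K(u,s) = 1`). [folklore] -/
theorem add_eval_eq_harmonicExt_add_markovRemainder (hd : 0 < d) (h : ℝ) (g : Site d → Ω → ℝ)
    (u : K) (ω : Ω) :
    h + g u ω = harmonicExt K (fun s => h + g s ω) u + markovRemainder K g u ω := by
  simp only [harmonicExt, markovRemainder, mul_add, Finset.sum_add_distrib]
  rw [← Finset.sum_mul, ← Finset.sum_coe_sort (outerBoundary (zdGraph d) K)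
      (fun s => poissonKernel K u s * g s ω)]
  have h1 : ∑ s : outerBoundary (zdGraph d) K, poissonKernel K u s = 1 := by
    rw [Finset.sum_coe_sort (outerBoundary (zdGraph d) K) (fun s => poissonKernel K u s)]
    exact sum_poissonKernel hd K u.2
  rw [h1]
  ring

/-- **Sign-flip invariance of the boundary-tilted law** (the analytic core of Lupu's symmetry of
bounded sign clusters, here for the discrete GFF `φ` of `ℤ^d`, `d ≥ 3`, at level `-h`): let `K` be
finite, `ψ = h + φ`, and let `W ≥ 0` be a measurable weight of `(ψ|_K, ψ|_{∂K})` such that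
`W(-f, b) = W(f, b) · exp(2 ∑_{u ∼ s} f_u b_s)` (e.g. the probability `∏ exp(-2 (f_u b_s)⁺)` that all
boundary cables are closed). Then the measure `W · Law(ψ|_K, ψ|_{∂K})` is invariant under
`(f, b) ↦ (-f, b)`. Proof: Markov decomposition `ψ|_K = H ψ|_{∂K} + Z`, `Z ⊥ ψ|_{∂K}` centred
Gaussian with covariance `G_K`; Cameron–Martin for `Z` with shift `2Hb = G_K (2β(b))`, symmetry
of `Z`, and `H·GaussianDensity` bookkeeping. (Lupu 2016, Lemma 3.2 / proof of Thm 1: conditionally on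
the closed edges the sign of a finite cluster is symmetric.) [cite: Lupu2016, Lemma 3.2 and proof of Prop. 4.2 (arXiv numbering)] -/
theorem IsDiscreteGFF.map_flip_withDensity_eq (hg : IsDiscreteGFF P g) (hd : 3 ≤ d) (h : ℝ)
    {W : (K → ℝ) × (outerBoundary (zdGraph d) K → ℝ) → ENNReal} (hW : Measurable W)
    (hWflip : ∀ f b, W (-f, b) = W (f, b) * ENNReal.ofReal (Real.exp (2 * boundaryPairing K f b))) :
    (((P.map fun ω => ((fun u : K => h + g u ω),
        (fun s : outerBoundary (zdGraph d) K => h + g s ω))).withDensity W).map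
        (fun q => (-q.1, q.2))) =
      (P.map fun ω => ((fun u : K => h + g u ω),
        (fun s : outerBoundary (zdGraph d) K => h + g s ω))).withDensity W := by
  classical
  have hprob := hg.isProbabilityMeasure
  have hd0 : 0 < d := by omega
  -- the random vectors
  set Zv : Ω → (K → ℝ) := fun ω u => markovRemainder K g u ω with hZv
  set bv : Ω → (outerBoundary (zdGraph d) K → ℝ) := fun ω s => h + g s ω with hbv
  set Ψ : Ω → (K → ℝ) × (outerBoundary (zdGraph d) K → ℝ) := fun ω => ((fun u : K => h + g u ω), bv ω) with hΨ
  have hZG : HasGaussianLaw Zv P := hg.hasGaussianLaw_markovRemainder K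
  have hZm : AEMeasurable Zv P := hZG.aemeasurable
  have hbm : AEMeasurable bv P :=
    aemeasurable_pi_lambda _ fun s => (hg.aemeasurable s).const_add h
  have hind : IndepFun Zv bv P := by
    have := (hg.indepFun_markovRemainder_boundary K hd).comp measurable_id
      (by fun_prop : Measurable fun (b : outerBoundary (zdGraph d) K → ℝ) (s : outerBoundary (zdGraph d) K) => h + b s)
    exact this
  have hpair : P.map (fun ω => (Zv ω, bv ω)) = (P.map Zv).prod (P.map bv) :=
    (indepFun_iff_map_prod_eq_prod_map_map hZm hbm).1 hind
  -- the decomposition `Ψ = (H b + z, b)` as a function of `(z, b)`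
  set E : (K → ℝ) × (outerBoundary (zdGraph d) K → ℝ) → (K → ℝ) × (outerBoundary (zdGraph d) K → ℝ) :=
    fun q => (fun u => harmonicExt K q.2 u + q.1 u, q.2) with hE
  have hEm : Measurable E := by
    simp only [hE, harmonicExt]
    fun_prop
  have hΨE : ∀ ω, Ψ ω = E (Zv ω, bv ω) := fun ω => by
    simp only [hΨ, hE, hZv, hbv]
    congr 1
    funext u
    exact add_eval_eq_harmonicExt_add_markovRemainder hd0 h g u ω
  have hΨm : AEMeasurable Ψ P := by
    have : Ψ = E ∘ fun ω => (Zv ω, bv ω) := funext hΨE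
    rw [this]
    exact hEm.comp_aemeasurable (hZm.prodMk hbm)
  -- reduce to an identity of set functions, written as integrals over `Ω`
  set T : (K → ℝ) × (outerBoundary (zdGraph d) K → ℝ) → (K → ℝ) × (outerBoundary (zdGraph d) K → ℝ) := fun q => (-q.1, q.2) with hT
  have hTm : Measurable T := by fun_prop
  ext S hS
  rw [Measure.map_apply hTm hS, withDensity_apply _ (hTm hS), withDensity_apply _ hS]
  have key : ∀ A : Set ((K → ℝ) × (outerBoundary (zdGraph d) K → ℝ)), MeasurableSet A →
      ∫⁻ q in A, W q ∂(P.map Ψ) = ∫⁻ ω, A.indicator W (E (Zv ω, bv ω)) ∂P := fun A hA => by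
    rw [← lintegral_indicator hA, lintegral_map' ((hW.indicator hA).aemeasurable) hΨm]
    exact lintegral_congr fun ω => by rw [hΨE]
  rw [key _ (hTm hS), key _ hS]
  -- disintegrate along the independent pair `(Z, b)`
  have hstep : ∀ (Φ : (K → ℝ) × (outerBoundary (zdGraph d) K → ℝ) → ENNReal), Measurable Φ →
      ∫⁻ ω, Φ (Zv ω, bv ω) ∂P = ∫⁻ b, ∫⁻ ω, Φ (Zv ω, b) ∂P ∂(P.map bv) := fun Φ hΦ => by
    rw [← lintegral_map' hΦ.aemeasurable (hZm.prodMk hbm), hpair, lintegral_prod_symm _ hΦ.aemeasurable]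
    refine lintegral_congr fun b => ?_
    exact lintegral_map' (f := fun z : K → ℝ => Φ (z, b))
      (hΦ.comp (by fun_prop : Measurable fun z : K → ℝ => (z, b))).aemeasurable hZm
  have hm1 : Measurable fun q : (K → ℝ) × (outerBoundary (zdGraph d) K → ℝ) => (T ⁻¹' S).indicator W (E q) :=
    (hW.indicator (hTm hS)).comp hEm
  have hm2 : Measurable fun q : (K → ℝ) × (outerBoundary (zdGraph d) K → ℝ) => S.indicator W (E q) :=
    (hW.indicator hS).comp hEm
  rw [hstep _ hm1, hstep _ hm2]
  refine lintegral_congr fun b => ?_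
  -- fixed boundary data `b`: Cameron–Martin flip for `Z` with shift `2Hb = G_K (2β(b))`
  set a : K → ℝ := fun u => 2 * harmonicExt K b u with ha
  set c : K → ℝ := fun u => 2 * boundarySource K b u with hc
  have hac : ∀ u, a u = ∑ v, cov[markovRemainder K g u, markovRemainder K g v; P] * c v := by
    intro u
    simp only [ha, hc, hg.covariance_markovRemainder K hd, harmonicExt_eq_sum_dirichletGreen,
      Finset.mul_sum]
    refine Finset.sum_congr rfl fun v _ => ?_
    ring
  set fz : (K → ℝ) → (K → ℝ) := fun z u => harmonicExt K b u + z u with hfz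
  have hfzm : Measurable fz := by simp only [hfz]; fun_prop
  set F : (K → ℝ) → ENNReal :=
    fun z => S.indicator (fun _ => (1 : ENNReal)) (fz z, b) * W (-fz z, b) with hF
  have hFm : Measurable F := by
    refine Measurable.mul ?_ ?_
    · exact (measurable_const.indicator hS).comp (by fun_prop)
    · exact hW.comp (by fun_prop)
  have hflip := Literature.Probability.Distributions.lintegral_comp_neg_sub_of_hasGaussianLaw
    (fun u ω => markovRemainder K g u ω) hZG (hg.integral_markovRemainder K) c a hac hFm
  -- identify the two sides of `hflip` with the two sides of the goal
  have e2 : ∀ ω, E (Zv ω, b) = (fz (Zv ω), b) := fun ω => rfl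
  have hleft : ∀ ω, F (fun u => -markovRemainder K g u ω - a u) =
      (T ⁻¹' S).indicator W (E (Zv ω, b)) := fun ω => by
    have e1 : fz (fun u => -markovRemainder K g u ω - a u) = -fz (Zv ω) := by
      funext u; simp only [hfz, ha, hZv, Pi.neg_apply]; ring
    rw [e2]
    show S.indicator (fun _ => (1 : ENNReal)) (fz (fun u => -markovRemainder K g u ω - a u), b) *
        W (-fz (fun u => -markovRemainder K g u ω - a u), b) =
      (T ⁻¹' S).indicator W (fz (Zv ω), b)
    rw [e1, neg_neg]
    by_cases hmem : (-fz (Zv ω), b) ∈ S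
    · rw [Set.indicator_of_mem hmem,
        Set.indicator_of_mem (show (fz (Zv ω), b) ∈ T ⁻¹' S from hmem), one_mul]
    · rw [Set.indicator_of_notMem hmem,
        Set.indicator_of_notMem (show (fz (Zv ω), b) ∉ T ⁻¹' S from hmem), zero_mul]
  have hright : ∀ ω, F (fun u => markovRemainder K g u ω) *
      ENNReal.ofReal (Real.exp (-∑ u, c u * markovRemainder K g u ω - (∑ u, c u * a u) / 2)) =
      S.indicator W (E (Zv ω, b)) := fun ω => by
    have hexp : 2 * boundaryPairing K (fz (Zv ω)) b +
        (-∑ u, c u * markovRemainder K g u ω - (∑ u, c u * a u) / 2) = 0 := by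
      simp only [boundaryPairing, hfz, hc, ha, hZv]
      rw [Finset.mul_sum, Finset.sum_div, ← Finset.sum_neg_distrib, ← Finset.sum_sub_distrib,
        ← Finset.sum_add_distrib]
      refine Finset.sum_eq_zero fun u _ => ?_
      ring
    calc F (fun u => markovRemainder K g u ω) *
          ENNReal.ofReal (Real.exp (-∑ u, c u * markovRemainder K g u ω - (∑ u, c u * a u) / 2))
        = S.indicator (fun _ => (1 : ENNReal)) (fz (Zv ω), b) * (W (fz (Zv ω), b) *
            (ENNReal.ofReal (Real.exp (2 * boundaryPairing K (fz (Zv ω)) b)) *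
              ENNReal.ofReal (Real.exp
                (-∑ u, c u * markovRemainder K g u ω - (∑ u, c u * a u) / 2)))) := by
          simp only [hF, hWflip, hZv]; ring
      _ = S.indicator (fun _ => (1 : ENNReal)) (fz (Zv ω), b) * W (fz (Zv ω), b) := by
          rw [← ENNReal.ofReal_mul (Real.exp_nonneg _), ← Real.exp_add, hexp, Real.exp_zero,
            ENNReal.ofReal_one, mul_one]
      _ = S.indicator W (E (Zv ω, b)) := by
          rw [e2]
          by_cases hmem : (fz (Zv ω), b) ∈ S
          · rw [Set.indicator_of_mem hmem, Set.indicator_of_mem hmem, one_mul]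
          · rw [Set.indicator_of_notMem hmem, Set.indicator_of_notMem hmem, zero_mul]
  simp only [hleft, hright] at hflip
  exact hflip

end Flip

/-! ### The Lupu boundary weight and the integral form of the flip invariance -/

section BoundaryWeight

variable (K : Finset (Site d))

/-- **The closed-boundary weight**: for field values `f` on `K` and `b` on `∂K`,
`W_K(f, b) = ∏_{u ∈ K, s ∈ ∂K, u ∼ s} exp(-2 (f_u b_s)⁺)` — given the discrete field, the
probability that every cable from `K` to `∂K` carries a zero of the cable-system field, i.e. that
all boundary edges of `K` are closed in the two-sided Lupu model (product of `1 -` two-sided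
weights). (Lupu 2016, Cor. 3.6.) [cite: Lupu2016, Cor. 3.6 (arXiv numbering)] -/
def closedBoundaryWeight (f : K → ℝ) (b : outerBoundary (zdGraph d) K → ℝ) : ℝ :=
  ∏ u : K, ∏ s : outerBoundary (zdGraph d) K,
    if (zdGraph d).Adj (u : Site d) s then Real.exp (-2 * max (f u * b s) 0) else 1

/-- The closed-boundary weight is non-negative. [folklore] -/
theorem closedBoundaryWeight_nonneg (f : K → ℝ) (b : outerBoundary (zdGraph d) K → ℝ) :
    0 ≤ closedBoundaryWeight K f b :=
  Finset.prod_nonneg fun u _ => Finset.prod_nonneg fun s _ => by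
    split_ifs
    · exact (Real.exp_pos _).le
    · exact zero_le_one

/-- The closed-boundary weight is a continuous (hence measurable) function of `(f, b)`. [folklore] -/
theorem measurable_closedBoundaryWeight :
    Measurable fun q : (K → ℝ) × (outerBoundary (zdGraph d) K → ℝ) =>
      closedBoundaryWeight K q.1 q.2 := by
  unfold closedBoundaryWeight
  refine Finset.measurable_prod _ fun u _ => Finset.measurable_prod _ fun s _ => ?_
  split_ifs
  · fun_prop
  · exact measurable_const

/-- **The flip relation of the boundary weight**: `W_K(-f, b) = W_K(f, b) · exp(2 ⟪f, b⟫)`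
(termwise, `-(−t)⁺ = -t⁺ + t`). [folklore] -/
theorem closedBoundaryWeight_neg (f : K → ℝ) (b : outerBoundary (zdGraph d) K → ℝ) :
    closedBoundaryWeight K (-f) b =
      closedBoundaryWeight K f b * Real.exp (2 * boundaryPairing K f b) := by
  simp only [closedBoundaryWeight, boundaryPairing, boundarySource, Finset.mul_sum, Real.exp_sum,
    ← Finset.prod_mul_distrib]
  refine Finset.prod_congr rfl fun u _ => Finset.prod_congr rfl fun s _ => ?_
  split_ifs
  · rw [← Real.exp_add, Pi.neg_apply]
    congr 1
    rcases le_total 0 (f u * b s) with h0 | h0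
    · rw [max_eq_right (by nlinarith), max_eq_left h0]; ring
    · rw [max_eq_left (by nlinarith), max_eq_right h0]; ring
  · simp

variable {K}

/-- **Integral form of the sign-flip invariance** (`d ≥ 3`): for the discrete GFF `φ`, `ψ = h + φ`,
a finite `K` and every measurable `G`,
`E[G(-ψ|_K, ψ|_{∂K}) W_K(ψ|_K, ψ|_{∂K})] = E[G(ψ|_K, ψ|_{∂K}) W_K(ψ|_K, ψ|_{∂K})]`.
(Lupu 2016, Lemma 3.2 / proof of Thm 1, vertex-trace form.) [cite: Lupu2016, Lemma 3.2 and proof of Prop. 4.2 (arXiv numbering)] -/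
theorem IsDiscreteGFF.integral_flip_closedBoundaryWeight (hg : IsDiscreteGFF P g) (hd : 3 ≤ d)
    (h : ℝ) {G : (K → ℝ) × (outerBoundary (zdGraph d) K → ℝ) → ℝ} (hG : Measurable G) :
    ∫ ω, G ((fun u : K => -(h + g u ω)), (fun s : outerBoundary (zdGraph d) K => h + g s ω)) *
        closedBoundaryWeight K (fun u : K => h + g u ω)
          (fun s : outerBoundary (zdGraph d) K => h + g s ω) ∂P =
      ∫ ω, G ((fun u : K => h + g u ω), (fun s : outerBoundary (zdGraph d) K => h + g s ω)) *
        closedBoundaryWeight K (fun u : K => h + g u ω)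
          (fun s : outerBoundary (zdGraph d) K => h + g s ω) ∂P := by
  set Ψ : Ω → (K → ℝ) × (outerBoundary (zdGraph d) K → ℝ) :=
    fun ω => ((fun u : K => h + g u ω), (fun s : outerBoundary (zdGraph d) K => h + g s ω)) with hΨ
  set W : (K → ℝ) × (outerBoundary (zdGraph d) K → ℝ) → ENNReal :=
    fun q => ENNReal.ofReal (closedBoundaryWeight K q.1 q.2) with hW
  have hWm : Measurable W := ENNReal.measurable_ofReal.comp (measurable_closedBoundaryWeight K)
  have hWflip : ∀ f b, W (-f, b) = W (f, b) * ENNReal.ofReal (Real.exp (2 * boundaryPairing K f b)) := by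
    intro f b
    simp only [hW, closedBoundaryWeight_neg]
    exact ENNReal.ofReal_mul (closedBoundaryWeight_nonneg K f b)
  have hflip := hg.map_flip_withDensity_eq (K := K) hd h hWm hWflip
  have hΨm : AEMeasurable Ψ P := by
    refine AEMeasurable.prodMk ?_ ?_
    · exact aemeasurable_pi_lambda _ fun u => (hg.aemeasurable u).const_add h
    · exact aemeasurable_pi_lambda _ fun s => (hg.aemeasurable s).const_add h
  set T : (K → ℝ) × (outerBoundary (zdGraph d) K → ℝ) → (K → ℝ) × (outerBoundary (zdGraph d) K → ℝ) :=
    fun q => (-q.1, q.2) with hT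
  have hTm : Measurable T := by fun_prop
  -- `∫ G d(W·PΨ) = ∫ G d((W·PΨ).map T) = ∫ G ∘ T d(W·PΨ)`
  have h1 : ∫ q, G q ∂((P.map Ψ).withDensity W) = ∫ q, G (T q) ∂((P.map Ψ).withDensity W) := by
    conv_lhs => rw [← hflip]
    exact integral_map hTm.aemeasurable hG.aestronglyMeasurable
  have hunfold : ∀ (F : (K → ℝ) × (outerBoundary (zdGraph d) K → ℝ) → ℝ), Measurable F →
      ∫ q, F q ∂((P.map Ψ).withDensity W) =
        ∫ ω, F (Ψ ω) * closedBoundaryWeight K (Ψ ω).1 (Ψ ω).2 ∂P := by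
    intro F hF
    rw [integral_withDensity_eq_integral_toReal_smul hWm
        (Filter.Eventually.of_forall fun _ => ENNReal.ofReal_lt_top),
      integral_map hΨm]
    · refine integral_congr_ae (Filter.Eventually.of_forall fun ω => ?_)
      simp only [hW, smul_eq_mul]
      rw [ENNReal.toReal_ofReal (closedBoundaryWeight_nonneg K _ _), mul_comm]
    · exact (Measurable.aestronglyMeasurable (by fun_prop))
  rw [hunfold G hG, hunfold (fun q => G (T q)) (hG.comp hTm)] at h1
  exact h1.symm

end BoundaryWeight

end Literature.Probability.LatticeModels

end
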